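import Literature.MathematicalPhysics.QuantumManyBody.PeriodicBoseGasCoulombFourier
import Literature.MathematicalPhysics.QuantumManyBody.BoseEinsteinCondensation
import HarnessLib

/-!
# Positivity of the Coulomb energy of a signed charge distribution (Lieb–Loss, Thm. 9.8)

Topic `Literature/MathematicalPhysics/QuantumManyBody`. For a real (signed) charge density
`f ∈ L¹(ℝ³)` with finite absolute Coulomb energy, the Coulomb self-energy is nonnegative:

`D(f, f) = ∬ f(x) f(y) / (4π|x - y|) dx dy ≥ 0`,

the positive-definiteness of the Coulomb kernel [LiebLoss2001, Thm. 9.8] behind Onsager's lemma,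
the Lieb–Oxford bound, the thermodynamic limit for jellium [LiebNarnhofer1975] and the a-priori
electrostatic estimates of the charged Bose gas [LiebSolovej2001, §3] (groundwork for the named
fact `JelliumBoseGas.foldyLaw`, [LSSY2005, Thm. 10.1]). The printed proof is via
`𝓕(|x|⁻¹) = 4π/k² ≥ 0`; here, without Plancherel for `f ∉ L²`, by Gaussian subordination exactly
as in the tree's `BoseGas.lintegral_normSq_fourier_div_eq` (`PeriodicBoseGasCoulombFourier.lean`):
`(4π|z|)⁻¹ = ∫₀^∞ G_s(z) ds` (`BoseGas.integral_Ioi_heatKernel`) and, for every `s > 0` and every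
real `f ∈ L¹`, `∬ f(x)f(y)G_s(x - y) = ∫ e^{-4π²s|p|²}|f̂(p)|² dp ≥ 0`
(`BoseGas.integral_heatSymbol_mul_normSq_fourier`); Fubini in `(x, y, s)` is justified by the
finiteness of the absolute Coulomb energy.

* `Coulomb.integrableOn_Ioi_heatKernel` — `s ↦ G_s(z)` is integrable on `(0, ∞)` for `z ≠ 0`.
* `Coulomb.integral_prod_gaussian_nonneg` — `0 ≤ ∬ f(x) f(y) G_s(x - y)` for real `f ∈ L¹`, `s > 0`.
* `Coulomb.coulombEnergy_eq_integral_Ioi` — `∬ f f (4π|x-y|)⁻¹ = ∫₀^∞ (∫ e^{-4π²s|p|²}|f̂(p)|² dp) ds`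
  with the `s`-integrand integrable on `(0, ∞)`, for real measurable `f ∈ L¹(ℝ³)` whose Coulomb
  integrand is absolutely integrable on `ℝ³ × ℝ³`.
* `Coulomb.coulombEnergy_nonneg` — **`0 ≤ ∬ f(x) f(y) (4π|x - y|)⁻¹`** (product-measure form);
  `Coulomb.coulombEnergy_nonneg'` — the same for the iterated integral.
* `Coulomb.coulombEnergy_eq_integral_normSq_fourier` — **`∬ f f (4π|x-y|)⁻¹ = ∫ |f̂(p)|²(4π²|p|²)⁻¹ dp`**
  with the right side integrable (the momentum-space form for signed densities).
* `Coulomb.coulombForm_symm` (`D(g,f) = D(f,g)`) and `Coulomb.coulombEnergy_cauchySchwarz` —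
  **`D(f,g)² ≤ D(f,f) D(g,g)`** (discriminant of `t ↦ D(f+tg, f+tg) ≥ 0`).
* `Coulomb.subordinatedKernel_bounds`, `Coulomb.subordinatedEnergy_nonneg` — for a measurable
  weight `0 ≤ w ≤ 1`, the kernel `k_w(z) = ∫₀^∞ w(s)G_s(z)ds ∈ [0, (4π|z|)⁻¹]` is positive
  definite on densities with finite absolute Coulomb energy (Yukawa `w = e^{-μs}`, its Coulomb
  complement `1 - e^{-μs}`, cut-offs `𝟙_{s≤T}`, …).

## References

* [LiebLoss2001] E. H. Lieb, M. Loss, *Analysis*, 2nd ed., AMS GSM 14 (2001), Thm. 9.8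
  (positivity properties of the Coulomb energy), Thm. 5.9.
* [LiebSolovej2001] E. H. Lieb, J. P. Solovej, Commun. Math. Phys. 217 (2001) 127–163, §3.
* [LSSY2005] E. H. Lieb, R. Seiringer, J. P. Solovej, J. Yngvason, *The Mathematics of the Bose
  Gas and its Condensation* (2005), Ch. 10.
-/

noncomputable section

open MeasureTheory Set Filter Real
open scoped ENNReal NNReal FourierTransform Topology
open Literature.Analysis.UnboundedOperators

namespace Literature.MathematicalPhysics.QuantumManyBody.Coulomb

open BoseGas

-- `Space = EuclideanSpace ℝ (Fin 3)` is the tree's `BoseGas.Space`.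

/-- `s ↦ G_s(z)` is integrable on `(0, ∞)` for `z ≠ 0` (its integral is the nonzero number
`(4π|z|)⁻¹`, `BoseGas.integral_Ioi_heatKernel`). [folklore] -/
theorem integrableOn_Ioi_heatKernel {z : Space} (hz : z ≠ 0) :
    IntegrableOn (fun s : ℝ => heatKernel s z) (Ioi 0) := by
  have hval := integral_Ioi_heatKernel hz
  have hpos : 0 < (4 * π * ‖z‖)⁻¹ := by
    have := norm_pos_iff.2 hz
    positivity
  by_contra h
  rw [IntegrableOn] at h
  rw [integral_undef h] at hval
  exact hpos.ne hval

/-- The heat kernel is jointly measurable in `(s, z)` on `ℝ × ℝ³`. [folklore] -/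
theorem measurable_heatKernel_uncurry : Measurable fun q : ℝ × Space => heatKernel q.1 q.2 := by
  have : (fun q : ℝ × Space => heatKernel q.1 q.2) =
      fun q => (4 * π * q.1) ^ (-(3 / 2 : ℝ)) * Real.exp (-‖q.2‖ ^ 2 / (4 * q.1)) :=
    funext fun q => heatKernel_three q.1 q.2
  rw [this]
  exact ((measurable_const.mul measurable_fst).pow_const _).mul (by fun_prop)

/-- For `s > 0` and real `f ∈ L¹(ℝ³)` the Gaussian-regularised kernel `f(x) f(y) G_s(x - y)` is
integrable on `ℝ³ × ℝ³` (the heat kernel is bounded by `(4πs)^{-3/2}`). [folklore] -/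
theorem integrable_prod_gaussian {f : Space → ℝ} (hfm : Measurable f) (hf : Integrable f) {s : ℝ}
    (hs : 0 < s) :
    Integrable (fun z : Space × Space => f z.1 * f z.2 * heatKernel s (z.1 - z.2))
      (volume.prod volume) := by
  have hGb : ∀ w : Space, |heatKernel s w| ≤ (4 * π * s) ^ (-(3 : ℝ) / 2) := fun w => by
    rw [abs_of_pos (heatKernel_pos hs w)]
    have h := heatKernel_le hs w
    rw [finrank_euclideanSpace_fin] at h
    exact_mod_cast h
  have hKm : Measurable fun z : Space × Space => f z.1 * f z.2 * heatKernel s (z.1 - z.2) :=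
    ((hfm.comp measurable_fst).mul (hfm.comp measurable_snd)).mul
      ((continuous_heatKernel s).measurable.comp (measurable_fst.sub measurable_snd))
  have hb : Integrable (fun z : Space × Space => ‖f z.1‖ * (‖f z.2‖ * (4 * π * s) ^ (-(3 : ℝ) / 2)))
      (volume.prod volume) :=
    hf.norm.mul_prod (hf.norm.mul_const _)
  refine hb.mono' hKm.aestronglyMeasurable (Eventually.of_forall fun z => ?_)
  rw [Real.norm_eq_abs, abs_mul, abs_mul, mul_assoc, ← Real.norm_eq_abs, ← Real.norm_eq_abs]
  gcongr
  exact hGb _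

/-- **Gaussian-regularised positivity**: `0 ≤ ∬ f(x) f(y) G_s(x - y) dx dy` for real `f ∈ L¹(ℝ³)`
and `s > 0`, since this equals `∫ e^{-4π²s|p|²} |f̂(p)|² dp`
(`BoseGas.integral_heatSymbol_mul_normSq_fourier`). [cite: LiebLoss2001, Thm. 9.8] -/
theorem integral_prod_gaussian_nonneg {f : Space → ℝ} (hfm : Measurable f) (hf : Integrable f)
    {s : ℝ} (hs : 0 < s) :
    0 ≤ ∫ z : Space × Space, f z.1 * f z.2 * heatKernel s (z.1 - z.2) ∂(volume.prod volume) := by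
  rw [integral_prod _ (integrable_prod_gaussian hfm hf hs),
    ← integral_heatSymbol_mul_normSq_fourier hfm hf hs]
  exact integral_nonneg fun p => mul_nonneg (heatSymbol_pos s p).le (sq_nonneg _)

/-- The diagonal of `ℝ³ × ℝ³` is null for Lebesgue measure. [folklore] -/
theorem ae_fst_ne_snd : ∀ᵐ z : Space × Space ∂(volume.prod volume), z.1 ≠ z.2 := by
  have hmeas : MeasurableSet {z : Space × Space | z.1 = z.2} :=
    (isClosed_eq continuous_fst continuous_snd).measurableSet
  have h0 : (volume.prod volume) {z : Space × Space | z.1 = z.2} = 0 := by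
    rw [Measure.measure_prod_null hmeas]
    refine Eventually.of_forall fun x => ?_
    have : Prod.mk x ⁻¹' {z : Space × Space | z.1 = z.2} = {x} := by
      ext y
      simp [eq_comm]
    simp only [this, measure_singleton, Pi.zero_apply]
  rw [ae_iff]
  simpa only [ne_eq, not_not] using h0

/-- For `s > 0` and real `f ∈ L¹(ℝ³)`, `p ↦ e^{-4π²s|p|²} |f̂(p)|²` is integrable (bounded
`|f̂|² ≤ ‖f‖₁²` against a Gaussian). [folklore] -/
theorem integrable_heatSymbol_mul_normSq_fourier {f : Space → ℝ} (hf : Integrable f) {s : ℝ}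
    (hs : 0 < s) :
    Integrable fun p : Space => heatSymbol s p * ‖𝓕 (fun x => (f x : ℂ)) p‖ ^ 2 := by
  set F : Space → ℂ := fun x => (f x : ℂ) with hFdef
  have hFi : Integrable F := hf.ofReal
  have hΦc : Continuous fun p => ‖𝓕 F p‖ ^ 2 := continuous_normSq_fourier hFi
  have hΦb : ∀ p, ‖𝓕 F p‖ ^ 2 ≤ (∫ x, ‖F x‖) ^ 2 := fun p => by
    gcongr
    exact VectorFourier.norm_fourierIntegral_le_integral_norm _ _ _ _ _
  have h := (integrable_heatSymbol (V := Space) hs).bdd_mul (c := (∫ x, ‖F x‖) ^ 2)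
    hΦc.aestronglyMeasurable (Eventually.of_forall fun p => ?_)
  · exact h.congr (Eventually.of_forall fun p => mul_comm _ _)
  · rw [Real.norm_of_nonneg (sq_nonneg _)]
    exact hΦb p

/-- **Subordination of the Coulomb energy** (signed densities). For a real measurable
`f ∈ L¹(ℝ³)` whose Coulomb integrand `f(x) f(y)/(4π|x - y|)` is absolutely integrable on
`ℝ³ × ℝ³`, the function `s ↦ ∫ e^{-4π²s|p|²} |f̂(p)|² dp` is integrable on `(0, ∞)` and
`∬ f(x) f(y) (4π|x - y|)⁻¹ d(x, y) = ∫₀^∞ (∫ e^{-4π²s|p|²} |f̂(p)|² dp) ds`: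
`(4π|x - y|)⁻¹ = ∫₀^∞ G_s(x - y) ds`, Fubini in `((x, y), s)` (absolute integrability), and the
Gaussian identity `∬ f f G_s = ∫ e^{-4π²s|·|²}|f̂|²` at each `s`. [cite: LiebLoss2001, Thm. 9.8] -/
theorem coulombEnergy_eq_integral_Ioi {f : Space → ℝ} (hfm : Measurable f) (hf : Integrable f)
    (hfin : Integrable (fun z : Space × Space => f z.1 * f z.2 * (4 * π * ‖z.1 - z.2‖)⁻¹)
      (volume.prod volume)) :
    IntegrableOn (fun s : ℝ => ∫ p : Space, heatSymbol s p * ‖𝓕 (fun x => (f x : ℂ)) p‖ ^ 2)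
        (Ioi 0) ∧
      ∫ z : Space × Space, f z.1 * f z.2 * (4 * π * ‖z.1 - z.2‖)⁻¹ ∂(volume.prod volume) =
        ∫ s in Ioi (0 : ℝ), ∫ p : Space, heatSymbol s p * ‖𝓕 (fun x => (f x : ℂ)) p‖ ^ 2 := by
  -- the subordinated kernel on `(ℝ³ × ℝ³) × (0, ∞)`
  set μ : Measure (Space × Space) := volume.prod volume with hμ
  set ν : Measure ℝ := volume.restrict (Ioi 0) with hν
  set K : (Space × Space) × ℝ → ℝ := fun q => f q.1.1 * f q.1.2 * heatKernel q.2 (q.1.1 - q.1.2)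
    with hK
  have hKm : Measurable K :=
    (((hfm.comp (measurable_fst.comp measurable_fst)).mul
      (hfm.comp (measurable_snd.comp measurable_fst))).mul
      (measurable_heatKernel_uncurry.comp (measurable_snd.prodMk
        ((measurable_fst.comp measurable_fst).sub (measurable_snd.comp measurable_fst)))))
  -- the `s`-integrals off the diagonal
  have hsec : ∀ z : Space × Space, z.1 ≠ z.2 →
      ∫ s in Ioi (0 : ℝ), K (z, s) = f z.1 * f z.2 * (4 * π * ‖z.1 - z.2‖)⁻¹ := by
    intro z hz
    simp only [hK]
    rw [integral_const_mul, integral_Ioi_heatKernel (sub_ne_zero.2 hz)]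
  have hsec_norm : ∀ z : Space × Space, z.1 ≠ z.2 →
      ∫ s in Ioi (0 : ℝ), ‖K (z, s)‖ = ‖f z.1 * f z.2 * (4 * π * ‖z.1 - z.2‖)⁻¹‖ := by
    intro z hz
    have hw : z.1 - z.2 ≠ 0 := sub_ne_zero.2 hz
    have hpos : 0 < (4 * π * ‖z.1 - z.2‖)⁻¹ := by
      have := norm_pos_iff.2 hw
      positivity
    have h1 : ∀ s ∈ Ioi (0 : ℝ), ‖K (z, s)‖ = |f z.1 * f z.2| * heatKernel s (z.1 - z.2) := by
      intro s hs
      simp only [hK, Real.norm_eq_abs, abs_mul, abs_of_pos (heatKernel_pos (show (0:ℝ) < s from hs) _)]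
    rw [setIntegral_congr_fun measurableSet_Ioi h1, integral_const_mul, integral_Ioi_heatKernel hw,
      Real.norm_eq_abs, abs_mul (f z.1 * f z.2) ((4 * π * ‖z.1 - z.2‖)⁻¹), abs_of_pos hpos]
  -- integrability of `K` on the product
  have hKi : Integrable K (μ.prod ν) := by
    rw [integrable_prod_iff hKm.aestronglyMeasurable]
    constructor
    · filter_upwards [ae_fst_ne_snd] with z hz
      simp only [hK]
      exact (integrableOn_Ioi_heatKernel (sub_ne_zero.2 hz)).const_mul _
    · refine hfin.norm.congr ?_
      filter_upwards [ae_fst_ne_snd] with z hz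
      exact (hsec_norm z hz).symm
  -- the `z`-integral at fixed `s > 0` is the Gaussian-regularised energy
  have hslice : ∀ s ∈ Ioi (0 : ℝ), ∫ z, K (z, s) ∂μ =
      ∫ p : Space, heatSymbol s p * ‖𝓕 (fun x => (f x : ℂ)) p‖ ^ 2 := by
    intro s hs
    simp only [hK, hμ]
    rw [integral_prod _ (integrable_prod_gaussian hfm hf hs),
      ← integral_heatSymbol_mul_normSq_fourier hfm hf hs]
  refine ⟨?_, ?_⟩
  · have hI : IntegrableOn (fun s => ∫ z, K (z, s) ∂μ) (Ioi 0) := by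
      have := hKi.integral_prod_right
      rw [hν] at this
      exact this
    exact hI.congr_fun hslice measurableSet_Ioi
  · -- Fubini both ways
    have h1 : ∫ q, K q ∂(μ.prod ν) = ∫ z, f z.1 * f z.2 * (4 * π * ‖z.1 - z.2‖)⁻¹ ∂μ := by
      rw [integral_prod _ hKi]
      refine integral_congr_ae ?_
      filter_upwards [ae_fst_ne_snd] with z hz
      exact hsec z hz
    have h2 : ∫ q, K q ∂(μ.prod ν) = ∫ s in Ioi (0 : ℝ), ∫ z, K (z, s) ∂μ := by
      rw [integral_prod_symm _ hKi]
    rw [← h1, h2]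
    exact setIntegral_congr_fun measurableSet_Ioi hslice

/-- **Positivity of the Coulomb energy** [LiebLoss2001, Thm. 9.8]. For a real measurable
`f ∈ L¹(ℝ³)` whose Coulomb integrand `f(x) f(y) / (4π|x - y|)` is absolutely integrable on
`ℝ³ × ℝ³` (finite absolute Coulomb energy), `0 ≤ ∬ f(x) f(y) (4π|x - y|)⁻¹ d(x, y)`
(by `coulombEnergy_eq_integral_Ioi` and `integral_prod_gaussian_nonneg`).
[cite: LiebLoss2001, Thm. 9.8] -/
theorem coulombEnergy_nonneg {f : Space → ℝ} (hfm : Measurable f) (hf : Integrable f)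
    (hfin : Integrable (fun z : Space × Space => f z.1 * f z.2 * (4 * π * ‖z.1 - z.2‖)⁻¹)
      (volume.prod volume)) :
    0 ≤ ∫ z : Space × Space, f z.1 * f z.2 * (4 * π * ‖z.1 - z.2‖)⁻¹ ∂(volume.prod volume) := by
  rw [(coulombEnergy_eq_integral_Ioi hfm hf hfin).2]
  refine setIntegral_nonneg measurableSet_Ioi fun s hs => ?_
  exact integral_nonneg fun p => mul_nonneg (heatSymbol_pos s p).le (sq_nonneg _)

/-- **Positivity of the Coulomb energy, iterated form**: under the same hypotheses,
`0 ≤ ∫ (∫ f(x) f(y) (4π|x - y|)⁻¹ dy) dx`. [cite: LiebLoss2001, Thm. 9.8] -/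
theorem coulombEnergy_nonneg' {f : Space → ℝ} (hfm : Measurable f) (hf : Integrable f)
    (hfin : Integrable (fun z : Space × Space => f z.1 * f z.2 * (4 * π * ‖z.1 - z.2‖)⁻¹)
      (volume.prod volume)) :
    0 ≤ ∫ x : Space, ∫ y : Space, f x * f y * (4 * π * ‖x - y‖)⁻¹ := by
  have h := coulombEnergy_nonneg hfm hf hfin
  rwa [integral_prod _ hfin] at h

/-- **The Coulomb energy in momentum space, signed densities** [LiebLoss2001, Thm. 9.8 with
Thm. 5.9]: under the hypotheses of `coulombEnergy_nonneg`, `p ↦ |f̂(p)|²/(4π²|p|²)` is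
integrable on `ℝ³` and `∬ f(x) f(y) (4π|x - y|)⁻¹ d(x, y) = ∫ |f̂(p)|² (4π²|p|²)⁻¹ dp`
(Mathlib's convention `f̂(p) = ∫ e^{-2πi⟨x,p⟩} f`; Tonelli in `(s, p)` on the nonnegative
`e^{-4π²s|p|²}|f̂(p)|²` and `∫₀^∞ e^{-4π²s|p|²} ds = (4π²|p|²)⁻¹`). [cite: LiebLoss2001, Thm. 9.8] -/
theorem coulombEnergy_eq_integral_normSq_fourier {f : Space → ℝ} (hfm : Measurable f)
    (hf : Integrable f)
    (hfin : Integrable (fun z : Space × Space => f z.1 * f z.2 * (4 * π * ‖z.1 - z.2‖)⁻¹)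
      (volume.prod volume)) :
    Integrable (fun p : Space =>
        ‖𝓕 (fun x => (f x : ℂ)) p‖ ^ 2 * ((2 * π) ^ 2 * ‖p‖ ^ 2)⁻¹) ∧
      ∫ z : Space × Space, f z.1 * f z.2 * (4 * π * ‖z.1 - z.2‖)⁻¹ ∂(volume.prod volume) =
        ∫ p : Space, ‖𝓕 (fun x => (f x : ℂ)) p‖ ^ 2 * ((2 * π) ^ 2 * ‖p‖ ^ 2)⁻¹ := by
  obtain ⟨hΦi, hEq⟩ := coulombEnergy_eq_integral_Ioi hfm hf hfin
  set F : Space → ℂ := fun x => (f x : ℂ) with hFdef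
  have hFi : Integrable F := hf.ofReal
  have hΦc : Continuous fun p => ‖𝓕 F p‖ ^ 2 := continuous_normSq_fourier hFi
  set Φ : ℝ → ℝ := fun s => ∫ p : Space, heatSymbol s p * ‖𝓕 F p‖ ^ 2 with hΦdef
  set h : Space → ℝ := fun p => ‖𝓕 F p‖ ^ 2 * ((2 * π) ^ 2 * ‖p‖ ^ 2)⁻¹ with hhdef
  have hh0 : ∀ p, 0 ≤ h p := fun p => by positivity
  have hhm : Measurable h :=
    hΦc.measurable.mul ((measurable_const.mul (continuous_norm.measurable.pow_const 2)).inv)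
  have hΦ0 : ∀ s, 0 ≤ Φ s := fun s =>
    integral_nonneg fun p => mul_nonneg (heatSymbol_pos s p).le (sq_nonneg _)
  -- joint measurability of the nonnegative integrand `e^{-4π²s|p|²}|f̂(p)|²`
  have hgm : Measurable fun q : ℝ × Space => heatSymbol q.1 q.2 * ‖𝓕 F q.2‖ ^ 2 := by
    have hsym_m : Measurable fun q : ℝ × Space => heatSymbol q.1 q.2 := by
      unfold heatSymbol; fun_prop
    exact hsym_m.mul (hΦc.measurable.comp measurable_snd)
  -- (i) `∫₀^∞ Φ = (∫⁻₀^∞ Φ).toReal`, finite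
  have hL1 : ∫ s in Ioi (0 : ℝ), Φ s = (∫⁻ s in Ioi (0 : ℝ), ENNReal.ofReal (Φ s)).toReal :=
    integral_eq_lintegral_of_nonneg_ae (Eventually.of_forall hΦ0) hΦi.aestronglyMeasurable
  have hLtop : ∫⁻ s in Ioi (0 : ℝ), ENNReal.ofReal (Φ s) ≠ ⊤ :=
    (lintegral_ofReal_ne_top_iff_integrable hΦi.aestronglyMeasurable (Eventually.of_forall hΦ0)).2
      hΦi
  -- (ii)–(iv) Tonelli in `(s, p)` and the subordination of `(4π²|p|²)⁻¹`
  have hae0 : ∀ᵐ p ∂(volume : Measure Space), p ≠ 0 := by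
    have : (volume : Measure Space) {p | ¬p ≠ 0} = 0 := by
      simp only [ne_eq, not_not, setOf_eq_eq_singleton, measure_singleton]
    exact ae_iff.2 this
  have hL2 : ∫⁻ s in Ioi (0 : ℝ), ENNReal.ofReal (Φ s) = ∫⁻ p, ENNReal.ofReal (h p) := by
    have e1 : ∀ s ∈ Ioi (0 : ℝ), ENNReal.ofReal (Φ s) =
        ∫⁻ p, ENNReal.ofReal (heatSymbol s p * ‖𝓕 F p‖ ^ 2) := fun s hs =>
      ofReal_integral_eq_lintegral_ofReal (integrable_heatSymbol_mul_normSq_fourier hf hs)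
        (Eventually.of_forall fun p => mul_nonneg (heatSymbol_pos s p).le (sq_nonneg _))
    rw [setLIntegral_congr_fun measurableSet_Ioi e1,
      lintegral_lintegral_swap (f := fun s p => ENNReal.ofReal (heatSymbol s p * ‖𝓕 F p‖ ^ 2))
        ((ENNReal.measurable_ofReal.comp hgm).aemeasurable)]
    refine lintegral_congr_ae ?_
    filter_upwards [hae0] with p hp
    have e2 : ∀ s, ENNReal.ofReal (heatSymbol s p * ‖𝓕 F p‖ ^ 2) =
        ENNReal.ofReal (‖𝓕 F p‖ ^ 2) * ENNReal.ofReal (heatSymbol s p) := fun s => by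
      rw [mul_comm, ENNReal.ofReal_mul (sq_nonneg _)]
    simp_rw [e2]
    rw [lintegral_const_mul' _ _ ENNReal.ofReal_ne_top, lintegral_Ioi_heatSymbol hp,
      ← ENNReal.ofReal_mul (sq_nonneg _)]
  -- (v)–(vi) finiteness gives integrability of `h`, and the identity
  have hhi : Integrable h := by
    refine (lintegral_ofReal_ne_top_iff_integrable hhm.aestronglyMeasurable
      (Eventually.of_forall hh0)).1 ?_
    rw [← hL2]
    exact hLtop
  refine ⟨hhi, ?_⟩
  rw [hEq, hL1, hL2, ← integral_eq_lintegral_of_nonneg_ae (Eventually.of_forall hh0)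
    hhm.aestronglyMeasurable]

/-! ### Symmetry and the Cauchy–Schwarz inequality for the Coulomb form -/

/-- **Symmetry of the Coulomb form** `D(g, f) = D(f, g)`, with the transfer of absolute
integrability (swap `x ↔ y`; the kernel is symmetric). [cite: LiebLoss2001, Thm. 9.8] -/
theorem coulombForm_symm {f g : Space → ℝ}
    (hfg : Integrable (fun z : Space × Space => f z.1 * g z.2 * (4 * π * ‖z.1 - z.2‖)⁻¹)
      (volume.prod volume)) :
    Integrable (fun z : Space × Space => g z.1 * f z.2 * (4 * π * ‖z.1 - z.2‖)⁻¹)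
        (volume.prod volume) ∧
      ∫ z : Space × Space, g z.1 * f z.2 * (4 * π * ‖z.1 - z.2‖)⁻¹ ∂(volume.prod volume) =
        ∫ z : Space × Space, f z.1 * g z.2 * (4 * π * ‖z.1 - z.2‖)⁻¹ ∂(volume.prod volume) := by
  have hswap : (fun z : Space × Space => f z.1 * g z.2 * (4 * π * ‖z.1 - z.2‖)⁻¹) ∘ Prod.swap =
      fun z : Space × Space => g z.1 * f z.2 * (4 * π * ‖z.1 - z.2‖)⁻¹ := by
    funext z
    simp only [Function.comp_apply, Prod.fst_swap, Prod.snd_swap, norm_sub_rev (z.2) (z.1)]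
    ring
  refine ⟨hswap ▸ hfg.swap, ?_⟩
  rw [← integral_prod_swap (fun z : Space × Space => f z.1 * g z.2 * (4 * π * ‖z.1 - z.2‖)⁻¹)]
  refine integral_congr_ae (Eventually.of_forall fun z => ?_)
  simp only [Prod.fst_swap, Prod.snd_swap, norm_sub_rev (z.2) (z.1)]
  ring

/-- **Cauchy–Schwarz for the Coulomb form** [LiebLoss2001, Thm. 9.8]: for real measurable
`f, g ∈ L¹(ℝ³)` with `D(|f|,|f|), D(|g|,|g|), D(|f|,|g|) < ∞` (absolute integrability of the
three Coulomb integrands on `ℝ³ × ℝ³`), `D(f, g)² ≤ D(f, f) D(g, g)` where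
`D(f, g) = ∬ f(x) g(y) (4π|x - y|)⁻¹`. Proof: `0 ≤ D(f + tg, f + tg) = D(f,f) + 2t D(f,g) + t² D(g,g)`
for all real `t` (`coulombEnergy_nonneg`, symmetry), so the discriminant is `≤ 0`.
[cite: LiebLoss2001, Thm. 9.8] -/
theorem coulombEnergy_cauchySchwarz {f g : Space → ℝ} (hfm : Measurable f) (hf : Integrable f)
    (hgm : Measurable g) (hg : Integrable g)
    (hff : Integrable (fun z : Space × Space => f z.1 * f z.2 * (4 * π * ‖z.1 - z.2‖)⁻¹)
      (volume.prod volume))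
    (hgg : Integrable (fun z : Space × Space => g z.1 * g z.2 * (4 * π * ‖z.1 - z.2‖)⁻¹)
      (volume.prod volume))
    (hfg : Integrable (fun z : Space × Space => f z.1 * g z.2 * (4 * π * ‖z.1 - z.2‖)⁻¹)
      (volume.prod volume)) :
    (∫ z : Space × Space, f z.1 * g z.2 * (4 * π * ‖z.1 - z.2‖)⁻¹ ∂(volume.prod volume)) ^ 2 ≤
      (∫ z : Space × Space, f z.1 * f z.2 * (4 * π * ‖z.1 - z.2‖)⁻¹ ∂(volume.prod volume)) *
        ∫ z : Space × Space, g z.1 * g z.2 * (4 * π * ‖z.1 - z.2‖)⁻¹ ∂(volume.prod volume) := by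
  set μ2 : Measure (Space × Space) := volume.prod volume with hμ2
  obtain ⟨hgf, hsymm⟩ := coulombForm_symm hfg
  set Dff : ℝ := ∫ z, f z.1 * f z.2 * (4 * π * ‖z.1 - z.2‖)⁻¹ ∂μ2 with hDff
  set Dgg : ℝ := ∫ z, g z.1 * g z.2 * (4 * π * ‖z.1 - z.2‖)⁻¹ ∂μ2 with hDgg
  set Dfg : ℝ := ∫ z, f z.1 * g z.2 * (4 * π * ‖z.1 - z.2‖)⁻¹ ∂μ2 with hDfg
  -- the quadratic polynomial `t ↦ D(f + tg, f + tg)` is nonnegative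
  have hquad : ∀ t : ℝ, 0 ≤ Dgg * (t * t) + 2 * Dfg * t + Dff := by
    intro t
    set h : Space → ℝ := fun x => f x + t * g x with hh
    have hhm : Measurable h := hfm.add (measurable_const.mul hgm)
    have hhi : Integrable h := hf.add (hg.const_mul t)
    have hexp : (fun z : Space × Space => h z.1 * h z.2 * (4 * π * ‖z.1 - z.2‖)⁻¹) =
        fun z => (f z.1 * f z.2 * (4 * π * ‖z.1 - z.2‖)⁻¹ +
          t * (f z.1 * g z.2 * (4 * π * ‖z.1 - z.2‖)⁻¹ + g z.1 * f z.2 * (4 * π * ‖z.1 - z.2‖)⁻¹)) +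
          t ^ 2 * (g z.1 * g z.2 * (4 * π * ‖z.1 - z.2‖)⁻¹) := by
      funext z
      simp only [hh]
      ring
    have hi2 : Integrable (fun z : Space × Space =>
        f z.1 * g z.2 * (4 * π * ‖z.1 - z.2‖)⁻¹ + g z.1 * f z.2 * (4 * π * ‖z.1 - z.2‖)⁻¹) μ2 :=
      hfg.add hgf
    have hi3 : Integrable (fun z : Space × Space =>
        t * (f z.1 * g z.2 * (4 * π * ‖z.1 - z.2‖)⁻¹ + g z.1 * f z.2 * (4 * π * ‖z.1 - z.2‖)⁻¹)) μ2 :=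
      hi2.const_mul t
    have hi1 : Integrable (fun z : Space × Space =>
        f z.1 * f z.2 * (4 * π * ‖z.1 - z.2‖)⁻¹ +
          t * (f z.1 * g z.2 * (4 * π * ‖z.1 - z.2‖)⁻¹ + g z.1 * f z.2 * (4 * π * ‖z.1 - z.2‖)⁻¹)) μ2 :=
      hff.add hi3
    have hi4 : Integrable (fun z : Space × Space =>
        t ^ 2 * (g z.1 * g z.2 * (4 * π * ‖z.1 - z.2‖)⁻¹)) μ2 := hgg.const_mul _
    have hhh : Integrable (fun z : Space × Space => h z.1 * h z.2 * (4 * π * ‖z.1 - z.2‖)⁻¹) μ2 := by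
      rw [hexp]
      exact hi1.add hi4
    have hpos := coulombEnergy_nonneg hhm hhi hhh
    have hval : ∫ z, h z.1 * h z.2 * (4 * π * ‖z.1 - z.2‖)⁻¹ ∂μ2 =
        Dff + t * (Dfg + Dfg) + t ^ 2 * Dgg := by
      rw [hexp, integral_add hi1 hi4, integral_add hff hi3, integral_const_mul, integral_const_mul,
        integral_add hfg hgf, hsymm]
    rw [hval] at hpos
    nlinarith [hpos]
  have hdisc := discrim_le_zero hquad
  rw [discrim] at hdisc
  nlinarith [hdisc]

/-! ### Subordinated kernels `k_w(z) = ∫₀^∞ w(s) G_s(z) ds`, `0 ≤ w ≤ 1` -/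

/-- For a measurable weight `0 ≤ w ≤ 1` on `(0, ∞)` and `z ≠ 0`, `s ↦ w(s) G_s(z)` is integrable
on `(0, ∞)` and `0 ≤ k_w(z) = ∫₀^∞ w(s) G_s(z) ds ≤ (4π|z|)⁻¹`. (Examples: `w = e^{-μs}` gives the
Yukawa potential `e^{-√μ|z|}/(4π|z|)`, `w = 1 - e^{-μs}` its complement to the Coulomb kernel.)
[folklore] -/
theorem subordinatedKernel_bounds {w : ℝ → ℝ} (hwm : Measurable w) (hw0 : ∀ s, 0 < s → 0 ≤ w s)
    (hw1 : ∀ s, 0 < s → w s ≤ 1) {z : Space} (hz : z ≠ 0) :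
    IntegrableOn (fun s : ℝ => w s * heatKernel s z) (Ioi 0) ∧
      0 ≤ ∫ s in Ioi (0 : ℝ), w s * heatKernel s z ∧
        ∫ s in Ioi (0 : ℝ), w s * heatKernel s z ≤ (4 * π * ‖z‖)⁻¹ := by
  have hG := integrableOn_Ioi_heatKernel hz
  have hint : IntegrableOn (fun s : ℝ => w s * heatKernel s z) (Ioi 0) := by
    refine Integrable.mono' hG (hwm.aestronglyMeasurable.mul hG.aestronglyMeasurable) ?_
    refine (ae_restrict_iff' measurableSet_Ioi).2 (Eventually.of_forall fun s hs => ?_)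
    have hs0 : (0 : ℝ) < s := hs
    rw [Real.norm_eq_abs, abs_mul, abs_of_nonneg (hw0 s hs0), abs_of_pos (heatKernel_pos hs0 z)]
    exact mul_le_of_le_one_left (heatKernel_pos hs0 z).le (hw1 s hs0)
  refine ⟨hint, ?_, ?_⟩
  · exact setIntegral_nonneg measurableSet_Ioi fun s hs =>
      mul_nonneg (hw0 s hs) (heatKernel_pos (show (0:ℝ) < s from hs) z).le
  · rw [← integral_Ioi_heatKernel hz]
    refine setIntegral_mono_on hint hG measurableSet_Ioi fun s hs => ?_
    exact mul_le_of_le_one_left (heatKernel_pos (show (0:ℝ) < s from hs) z).le (hw1 s hs)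

/-- **Positivity of subordinated Coulomb-type energies.** For a measurable weight `0 ≤ w ≤ 1` on
`(0, ∞)` and a real measurable `f ∈ L¹(ℝ³)` with finite absolute Coulomb energy,
`0 ≤ ∬ f(x) f(y) k_w(x - y) d(x, y)`, `k_w(z) = ∫₀^∞ w(s) G_s(z) ds`, and the integrand is
absolutely integrable: Fubini in `((x, y), s)` (domination by the Coulomb case) and
`∬ f f G_s ≥ 0` for each `s` (`integral_prod_gaussian_nonneg`). With `w = e^{-μs}`,
`1 - e^{-μs}`, `𝟙_{s ≤ T}`, … this is the positive-definiteness of the Yukawa potential, of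
`|x|⁻¹ - Y_μ(x)`, and of the short/long-distance pieces of the Coulomb kernel used in the
electrostatic estimates of [LiebSolovej2001, §3–4]. [cite: LiebLoss2001, Thm. 9.8] -/
theorem subordinatedEnergy_nonneg {w : ℝ → ℝ} (hwm : Measurable w) (hw0 : ∀ s, 0 < s → 0 ≤ w s)
    (hw1 : ∀ s, 0 < s → w s ≤ 1) {f : Space → ℝ} (hfm : Measurable f) (hf : Integrable f)
    (hfin : Integrable (fun z : Space × Space => f z.1 * f z.2 * (4 * π * ‖z.1 - z.2‖)⁻¹)
      (volume.prod volume)) :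
    Integrable (fun z : Space × Space =>
        f z.1 * f z.2 * (∫ s in Ioi (0 : ℝ), w s * heatKernel s (z.1 - z.2))) (volume.prod volume) ∧
      0 ≤ ∫ z : Space × Space, f z.1 * f z.2 * (∫ s in Ioi (0 : ℝ), w s * heatKernel s (z.1 - z.2))
        ∂(volume.prod volume) := by
  set μ : Measure (Space × Space) := volume.prod volume with hμ
  set ν : Measure ℝ := volume.restrict (Ioi 0) with hν
  set K : (Space × Space) × ℝ → ℝ :=
    fun q => f q.1.1 * f q.1.2 * (w q.2 * heatKernel q.2 (q.1.1 - q.1.2)) with hK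
  have hKm : Measurable K :=
    (((hfm.comp (measurable_fst.comp measurable_fst)).mul
      (hfm.comp (measurable_snd.comp measurable_fst))).mul
      ((hwm.comp measurable_snd).mul (measurable_heatKernel_uncurry.comp (measurable_snd.prodMk
        ((measurable_fst.comp measurable_fst).sub (measurable_snd.comp measurable_fst))))))
  -- sections off the diagonal
  have hsec : ∀ z : Space × Space, z.1 ≠ z.2 →
      ∫ s in Ioi (0 : ℝ), K (z, s) =
        f z.1 * f z.2 * (∫ s in Ioi (0 : ℝ), w s * heatKernel s (z.1 - z.2)) := by
    intro z hz
    simp only [hK]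
    rw [integral_const_mul]
  have hsec_norm : ∀ z : Space × Space, z.1 ≠ z.2 →
      ∫ s in Ioi (0 : ℝ), ‖K (z, s)‖ ≤ ‖f z.1 * f z.2 * (4 * π * ‖z.1 - z.2‖)⁻¹‖ := by
    intro z hz
    have hw : z.1 - z.2 ≠ 0 := sub_ne_zero.2 hz
    obtain ⟨hint, h0, hle⟩ := subordinatedKernel_bounds hwm hw0 hw1 hw
    have hpos : 0 < (4 * π * ‖z.1 - z.2‖)⁻¹ := by
      have := norm_pos_iff.2 hw
      positivity
    have h1 : ∀ s ∈ Ioi (0 : ℝ), ‖K (z, s)‖ = |f z.1 * f z.2| * (w s * heatKernel s (z.1 - z.2)) := by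
      intro s hs
      have hs0 : (0:ℝ) < s := hs
      simp only [hK, Real.norm_eq_abs, abs_mul, abs_of_nonneg (hw0 s hs0),
        abs_of_pos (heatKernel_pos hs0 _)]
    rw [setIntegral_congr_fun measurableSet_Ioi h1, integral_const_mul, Real.norm_eq_abs,
      abs_mul (f z.1 * f z.2) ((4 * π * ‖z.1 - z.2‖)⁻¹), abs_of_pos hpos]
    exact mul_le_mul_of_nonneg_left hle (abs_nonneg _)
  -- integrability of `K` on the product (domination by the Coulomb case)
  have hKi : Integrable K (μ.prod ν) := by
    rw [integrable_prod_iff hKm.aestronglyMeasurable]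
    constructor
    · filter_upwards [ae_fst_ne_snd] with z hz
      simp only [hK]
      exact (subordinatedKernel_bounds hwm hw0 hw1 (sub_ne_zero.2 hz)).1.const_mul _
    · have hae : AEStronglyMeasurable (fun z => ∫ s, ‖K (z, s)‖ ∂ν) μ :=
        hKm.norm.aestronglyMeasurable.integral_prod_right'
      refine hfin.norm.mono' hae ?_
      filter_upwards [ae_fst_ne_snd] with z hz
      rw [Real.norm_of_nonneg (integral_nonneg fun s => norm_nonneg _)]
      exact hsec_norm z hz
  refine ⟨?_, ?_⟩
  · have hI : Integrable (fun z => ∫ s, K (z, s) ∂ν) μ := hKi.integral_prod_left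
    refine hI.congr ?_
    filter_upwards [ae_fst_ne_snd] with z hz
    exact hsec z hz
  · have h1 : ∫ q, K q ∂(μ.prod ν) =
        ∫ z, f z.1 * f z.2 * (∫ s in Ioi (0 : ℝ), w s * heatKernel s (z.1 - z.2)) ∂μ := by
      rw [integral_prod _ hKi]
      refine integral_congr_ae ?_
      filter_upwards [ae_fst_ne_snd] with z hz
      exact hsec z hz
    have h2 : ∫ q, K q ∂(μ.prod ν) = ∫ s in Ioi (0 : ℝ), ∫ z, K (z, s) ∂μ := by
      rw [integral_prod_symm _ hKi]
    rw [← h1, h2]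
    refine setIntegral_nonneg measurableSet_Ioi fun s hs => ?_
    have hs0 : (0:ℝ) < s := hs
    have h3 : ∫ z, K (z, s) ∂μ = w s * ∫ z, f z.1 * f z.2 * heatKernel s (z.1 - z.2) ∂μ := by
      rw [← integral_const_mul]
      refine integral_congr_ae (Eventually.of_forall fun z => ?_)
      simp only [hK]
      ring
    rw [h3]
    exact mul_nonneg (hw0 s hs0) (integral_prod_gaussian_nonneg hfm hf hs0)

end Literature.MathematicalPhysics.QuantumManyBody.Coulomb
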